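import Mathlib
import Summits.Ventures.PercRepro.TriangleCapBelowGen

/-!
# PercRepro — THE SECOND-BEST VALUE TWO BELOW THE DIAGONAL, EVERY ROW `a ≥ 5`: on the cell `(k, a, 2)`,
`k ≥ 2a + 2`, the second-best value of `Σ_v d(v)²` over the non-extremal `K₄⁻`-free graphs is EXACTLY
`m k − 2 (k − 3) − 2` — the matching `B1 = 2` of §10bt(b), attained by `K_{a,k−a}` minus two disjoint cross pairs
(p3, gen 44; part 196d)

The `a`-bipartite non-extremal graphs are `2` below (`closed_form_stability_bipSub_two`: two missing pairs that are
not a star), the non-`a`-bipartite ones are `B2 = 2 (k − 2a − 1)(a − 2) ≥ 2` below (`two_below_second_order_gen`,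
part 196c), and the matching attains `2`: `matchingTwoGen n a := delEdge (bipMinusStar n a 1) 1 (n − 1)` — the
pairs `{0, a}` and `{1, n − 1}` are disjoint. With part 194 (`a = 3`) and the row `a = 4` open (there `r = 2 = a − 2`
and the one-triangle family competes), this completes the second-best value on every cell `(k, a, 2)` with
`a ≠ 4`, `k ≥ 2a + 2`. Axioms: standard.
-/

namespace PercRepro

namespace TriangleCap

namespace C047

open Finset

variable {V : Type*} [Fintype V] [DecidableEq V]

/-- The edge `{1, n − 1}` of `bipMinusStar n a 1` (`2 ≤ a`, `a + 2 ≤ n`). -/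
theorem bipMinusStar_adj_one_last_gen (n a : ℕ) (ha : 2 ≤ a) (hn : a + 2 ≤ n) :
    (bipMinusStar n a 1).Adj ⟨1, by omega⟩ ⟨n - 1, by omega⟩ := by
  rw [bipMinusStar_adj]
  simp only
  exact ⟨Or.inl ⟨by omega, by omega⟩, by omega⟩

/-- The degree of `1` in `bipMinusStar n a 1` is `n − a`. -/
theorem deg_bipMinusStar_one_gen (n a : ℕ) (ha : 2 ≤ a) (hn : a + 2 ≤ n) :
    deg (bipMinusStar n a 1) ⟨1, by omega⟩ = n - a := by
  rw [deg_bipMinusStar n a 1 (by omega) (by omega)]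
  simp only [rightStar, mem_filter, mem_univ, true_and]
  rw [if_neg (by omega), if_neg (by omega)]
  exact deg_bip_of_lt n a (by omega) _ (by simp only; omega)

/-- The degree of `n − 1` in `bipMinusStar n a 1` is `a`. -/
theorem deg_bipMinusStar_last_gen (n a : ℕ) (ha : 2 ≤ a) (hn : a + 2 ≤ n) :
    deg (bipMinusStar n a 1) ⟨n - 1, by omega⟩ = a := by
  rw [deg_bipMinusStar n a 1 (by omega) (by omega)]
  simp only [rightStar, mem_filter, mem_univ, true_and]
  rw [if_neg (by omega), if_neg (by omega)]
  exact deg_bip_of_not_lt n a (by omega) _ (by simp only; omega)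

/-- **THE MATCHING WITNESS AT `r = 2`, EVERY ROW:** `K_{a,n−a}` minus the two disjoint cross pairs `{0, a}` and
`{1, n − 1}` (`2 ≤ a`, `a + 2 ≤ n`). -/
abbrev matchingTwoGen (n a : ℕ) (hn : 2 ≤ n) : SimpleGraph (Fin n) :=
  delEdge (bipMinusStar n a 1) ⟨1, by omega⟩ ⟨n - 1, by omega⟩

/-- The arithmetic of the matching witness: from the sums of `bipMinusStar n a 1` (`E + 1 = a (n − a)`,
`S + (2n − 2) = a (n − a) n`) and the edge deletion (`E' + 1 = E`, `S' + 2 (n − a + a) = S + 2`):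
`E' + 2 = a (n − a)` and `S' + 2 (n − 3) + 2 = E' n`. -/
theorem matchingTwoGen_arith (n a S S' E E' : ℕ) (ha : 2 ≤ a) (hn : a + 2 ≤ n)
    (hE : E + 1 = a * (n - a)) (hS : S + 1 * (2 * n - 1 - 1) = a * (n - a) * n)
    (hE' : E' + 1 = E) (hS' : S' + 2 * (n - a + a) = S + 2) :
    E' + 2 = a * (n - a) ∧ S' + 2 * (n - 1 - 2) + 2 = E' * n := by
  obtain ⟨t, rfl⟩ : ∃ t, n = a + 2 + t := ⟨n - (a + 2), by omega⟩
  have e1 : a + 2 + t - a = t + 2 := by omega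
  have e2 : 2 * (a + 2 + t) - 1 - 1 = 2 * a + 2 + 2 * t := by omega
  have e3 : a + 2 + t - 1 - 2 = a + t - 1 := by omega
  rw [e1] at hE hS hS'
  rw [e1, e3]
  obtain ⟨u, rfl⟩ : ∃ u, a = u + 2 := ⟨a - 2, by omega⟩
  have e4 : u + 2 + t - 1 = u + t + 1 := by omega
  rw [e4]
  rw [e2] at hS
  subst hE'
  refine ⟨by omega, ?_⟩
  nlinarith [hE, hS, hS']

/-- **THE VALUE OF THE MATCHING WITNESS:** `K₄⁻`-free, `a (n − a) − 2` edges, `Σ_v d(v)² + 2 (n − 1 − 2) + 2 = m n`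
(`2 ≤ a`, `a + 2 ≤ n`). -/
theorem matchingTwoGen_value (n a : ℕ) (ha : 2 ≤ a) (hn : a + 2 ≤ n) (hn2 : 2 ≤ n) :
    K4mFree (matchingTwoGen n a hn2) ∧ (matchingTwoGen n a hn2).edgeFinset.card + 2 = a * (n - a) ∧
      ∑ v, deg (matchingTwoGen n a hn2) v * deg (matchingTwoGen n a hn2) v + 2 * (n - 1 - 2) + 2 =
        (matchingTwoGen n a hn2).edgeFinset.card * n := by
  have hadj := bipMinusStar_adj_one_last_gen n a ha hn
  have hE := card_edges_bipMinusStar n a 1 (by omega) (by omega)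
  have hS := (sums_bipMinusStar n a 1 (by omega) (by omega)).2
  have hd1 := deg_bipMinusStar_one_gen n a ha hn
  have hd2 := deg_bipMinusStar_last_gen n a ha hn
  have hE' : (matchingTwoGen n a hn2).edgeFinset.card + 1 = (bipMinusStar n a 1).edgeFinset.card :=
    card_edges_delEdge (bipMinusStar n a 1) hadj
  have hS' : ∑ v, deg (matchingTwoGen n a hn2) v * deg (matchingTwoGen n a hn2) v +
      2 * (deg (bipMinusStar n a 1) ⟨1, by omega⟩ + deg (bipMinusStar n a 1) ⟨n - 1, by omega⟩) =
      ∑ v, deg (bipMinusStar n a 1) v * deg (bipMinusStar n a 1) v + 2 :=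
    sum_deg_sq_delEdge (bipMinusStar n a 1) hadj
  rw [hd1, hd2] at hS'
  refine ⟨k4mFree_of_le _ _ (delEdge_le _ _ _) (k4mFree_bipMinusStar n a 1), ?_⟩
  exact matchingTwoGen_arith n a _ _ _ _ ha hn hE hS hE' hS'

/-- **THE SECOND-BEST VALUE TWO BELOW THE DIAGONAL, EVERY ROW `a ≥ 5`:** for `2a + 2 ≤ k`, every non-extremal
`K₄⁻`-free graph on `Fin k` with `a (k − a) − 2` edges has `Σ_v d(v)² + 2 (k − 3) + 2 ≤ m k`, and the value is
attained by `K_{a,k−a}` minus two disjoint cross pairs. -/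
theorem two_below_second_best_gen (k a : ℕ) (ha : 5 ≤ a) (hk : 2 * a + 2 ≤ k) :
    (∀ (D : SimpleGraph (Fin k)) [DecidableRel D.Adj], K4mFree D → D.edgeFinset.card + 2 = a * (k - a) →
        ∑ v, deg D v * deg D v + 2 * (k - 3) ≠ D.edgeFinset.card * k →
        ∑ v, deg D v * deg D v + 2 * (k - 3) + 2 ≤ D.edgeFinset.card * k) ∧
      ∃ (D : SimpleGraph (Fin k)) (_ : DecidableRel D.Adj), K4mFree D ∧ D.edgeFinset.card + 2 = a * (k - a) ∧
        ∑ v, deg D v * deg D v + 2 * (k - 3) + 2 = D.edgeFinset.card * k := by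
  have hcard : Fintype.card (Fin k) = k := Fintype.card_fin k
  refine ⟨?_, ?_⟩
  · intro D _ hK hm hne
    rcases two_below_second_order_gen D hK a ha (by omega) (by rw [hcard]; exact hm) with ⟨A, hAcard, hA⟩ | h
    · -- the bipartite half: not a star (else extremal), so `2` below
      have hns : ¬ ∃ v, MissingStar D A v := by
        rintro ⟨v, hv⟩
        apply hne
        have h := closed_form_eq_of_missingStar D A hA hv a 2 hAcard (by rw [hcard]; exact hm) (by omega)
        have e : Fintype.card (Fin k) - 1 - 2 = k - 3 := by rw [hcard]; omega
        rw [e, hcard] at h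
        exact h
      have h := closed_form_stability_bipSub_two D A hA a hAcard (by rw [hcard]; exact hm) (by omega) hns
      have e : Fintype.card (Fin k) - 1 - 2 = k - 3 := by rw [hcard]; omega
      rw [e, hcard] at h
      exact h
    · -- the non-bipartite half: `B2 = 2 (k − 2a − 1)(a − 2) ≥ 2`
      rw [hcard] at h
      have hB : 2 ≤ 2 * (k - 2 * a - 1) * (a - 2) := by
        have h1 : 1 ≤ k - 2 * a - 1 := by omega
        have h2 : 1 ≤ a - 2 := by omega
        nlinarith
      omega
  · obtain ⟨hK, hE, hS⟩ := matchingTwoGen_value k a (by omega) (by omega) (by omega)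
    have e : k - 1 - 2 = k - 3 := by omega
    rw [e] at hS
    exact ⟨matchingTwoGen k a (by omega), inferInstance, hK, hE, hS⟩

end C047

end TriangleCap

end PercRepro
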